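import Literature.AlgebraicGeometry.GroupSchemes.WeilGluingStepLawData
import Literature.AlgebraicGeometry.GroupSchemes.WeilGluingStepStrict
import Literature.AlgebraicGeometry.GroupSchemes.LawAssocOfSubLaw
import HarnessLib

/-!
# Weil's gluing step, the law on `V′ = V ∪ V_s` (V): the STRICT birational group law on the glued scheme
# (Artin, *Néron models*, §2, Lemma 2.4)

Topic `Literature/AlgebraicGeometry/GroupSchemes`, namespace `Literature.AlgebraicGeometry.GroupSchemes`.
KERNEL ONLY: one theorem; no definition, no named fact, no instance, no `sorry`.  Cell `hodgecm-mathlib`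
(D-0151), road W (Néron capital), piece (G2b) of the W1c design (`A-provers/A-p06/W1c-DESIGN.A-p06g5.md`), head
of the series `WeilGluingStep{RightChart, LeftChart, LawData, Strict}`.

`exists_isStrict_weilGluingStep` — [Artin1986NeronModels] Lemma 2.4 «`V` is dense in each fibre of `V′`, and `V′`
has property (2.2)» in the tree's currency: given a STRICT birational group law `L` on `𝒱 → S`, a section `s`, its
right translate chart `ρ = eρ ≫ mul : A ↪ 𝒱` and left translate chart `λ = el ≫ mul : A′ ↪ 𝒱` (★
`BirationalGroupLaw.exists_rightTranslate` / `exists_leftTranslate`, entered through the slice embeddings `σ`, `σ′`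
and lifts `eρ`, `el`), the glued scheme `𝒲` with its two charts `i₁, i₂ : 𝒱 → 𝒲` (★ `exists_selfGluing`:
`ρ ≫ i₁ = ι_A ≫ i₂`, jointly surjective) and the parameter scheme `P` («`𝒱 ×_S A′`», two open immersions `θι`,
`θl` into `𝒱 ×_S 𝒱`), there is a STRICT birational group law `L″` on `𝒲` EXTENDING `L` along `i₁` (a morphism
`φ : dom → dom″` over `i₁ ⊗ i₁` intertwining the multiplications).  Assembly: law data and open-immersion shears
from part III, the nine densities from part IV, associativity by ★ `LawData.assoc_of_le` (B-p15) from the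
transported law on `(i₁ ⊗ i₁)(dom)` (★ `BirationalGroupLaw.assoc_chart`) and the non-empty witness configuration
`(x, b)`, `(b, s)`, `(x b, s)`, `(x, b s)` over `Ω ⊆ 𝒱 ×_S A`.

Hypotheses are stated over an arbitrary base `S` with the irreducibility / reducedness / separatedness instances
and the preirreducibility of slice fibres listed explicitly; over a discrete valuation ring they all follow from
`𝒱 → S`, `𝒲 → S` smooth, separated, with geometrically irreducible fibres (★ `StrictOpenChunkInstances`,
Mathlib `GeometricallyIrreducible`), which is how the W1c step (`StageStep`) consumes this theorem.
[Artin1986NeronModels] M. Artin, *Néron models*, in Cornell–Silverman, *Arithmetic Geometry* (1986), §2, Lemma 2.4,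
p. 222 (held: `book:cornellnd-arithmetic-geometry` p0293); [EdixhovenRomagny] Def. 3.4 (held).
HC_CM is not proved here; nothing here changes the floor.

## References
* [Artin1986NeronModels] M. Artin, *Néron models*, in *Arithmetic Geometry* (Cornell, Silverman eds.), Springer 1986, §2.
* [EdixhovenRomagny] B. Edixhoven, M. Romagny, *Group schemes out of birational group laws, Néron models*, Panor. Synthèses 47 (2015), §3.
-/

noncomputable section

namespace Literature.AlgebraicGeometry.GroupSchemes

open CategoryTheory CategoryTheory.Limits _root_.AlgebraicGeometry MonoidalCategory CartesianMonoidalCategory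
  TopologicalSpace
open scoped CategoryTheory.Obj

universe u

section Head

variable {S : Scheme.{u}} {𝒱 𝒲 : Over S} (L : BirationalGroupLaw 𝒱)
  (i₁ i₂ : 𝒱 ⟶ 𝒲) [IsOpenImmersion i₁.left] [IsOpenImmersion i₂.left]
  (s : S ⟶ 𝒱.left)
  (σ : 𝒱.left ⟶ (𝒱 ⊗ 𝒱).left) (hσ₁ : σ ≫ (fst 𝒱 𝒱).left = 𝟙 _) (hσ₂ : σ ≫ (snd 𝒱 𝒱).left = 𝒱.hom ≫ s)
  (A : 𝒱.left.Opens) (eρ : (A : Scheme.{u}) ⟶ (L.dom : Scheme.{u})) (heρ : eρ ≫ L.dom.ι = A.ι ≫ σ)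
  (hρo : IsOpenImmersion (eρ ≫ L.mul)) (hglue : (eρ ≫ L.mul) ≫ i₁.left = A.ι ≫ i₂.left)
  (σ' : 𝒱.left ⟶ (𝒱 ⊗ 𝒱).left) (hσ'₁ : σ' ≫ (fst 𝒱 𝒱).left = 𝒱.hom ≫ s) (hσ'₂ : σ' ≫ (snd 𝒱 𝒱).left = 𝟙 _)
  (A' : 𝒱.left.Opens) (el : (A' : Scheme.{u}) ⟶ (L.dom : Scheme.{u})) (hel : el ≫ L.dom.ι = A'.ι ≫ σ')
  (hlo : IsOpenImmersion (el ≫ L.mul))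
  {P : Scheme.{u}} (πV : P ⟶ 𝒱.left) (πA : P ⟶ (A' : Scheme.{u})) (θι θl : P ⟶ (𝒱 ⊗ 𝒱).left)
  [IsOpenImmersion θι] [IsOpenImmersion θl]
  (hθι₁ : θι ≫ (fst 𝒱 𝒱).left = πV) (hθι₂ : θι ≫ (snd 𝒱 𝒱).left = πA ≫ A'.ι)
  (hθl₁ : θl ≫ (fst 𝒱 𝒱).left = πV) (hθl₂ : θl ≫ (snd 𝒱 𝒱).left = πA ≫ el ≫ L.mul)
  (hP : ∀ w : ↑(𝒱 ⊗ 𝒱).left, (snd 𝒱 𝒱).left.base w ∈ A' → w ∈ Set.range θι.base)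
  (hPl : ∀ w : ↑(𝒱 ⊗ 𝒱).left, (snd 𝒱 𝒱).left.base w ∈ Set.range (el ≫ L.mul).base → w ∈ Set.range θl.base)

include hσ₁ hσ₂ heρ hρo hglue hσ'₁ hσ'₂ hel hlo hθι₁ hθι₂ hθl₁ hθl₂ hP hPl in
/-- **Weil's gluing step: the strict birational group law on `V′ = V ∪_{W_s} V_s`** ([Artin1986NeronModels] §2,
Lemma 2.4; [EdixhovenRomagny] Def. 3.4).  See the module docstring for the notation and the list of hypotheses.
Conclusion: a STRICT birational group law `L″` on the glued scheme `𝒲` and a morphism `φ : dom → dom″` with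
`φ ≫ ι″ = ι ≫ (i₁ ⊗ i₁)` and `φ ≫ mul″ = mul ≫ i₁` (the law of `𝒲` extends the law of `𝒱` along the chart `i₁`).
[cite: Artin1986NeronModels, §2 Lemma 2.4 p. 222] [cite: EdixhovenRomagny, Def. 3.4] -/
theorem exists_isStrict_weilGluingStep
    [IrreducibleSpace ↑(𝒱 ⊗ 𝒱).left] [IrreducibleSpace ↑(𝒲 ⊗ 𝒲).left] [IrreducibleSpace ↑((𝒲 ⊗ 𝒲) ⊗ 𝒲).left]
    [IsReduced ↑(𝒲 ⊗ 𝒲).left] [IsReduced ↑((𝒲 ⊗ 𝒲) ⊗ 𝒲).left]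
    [𝒲.left.IsSeparated] [(𝒲 ⊗ 𝒲).left.IsSeparated] [S.IsSeparated] [IsSeparated 𝒲.hom]
    (hA : (A : Set 𝒱.left).Nonempty) (hA' : IsFibrewiseDense 𝒱.hom (A' : Set 𝒱.left)) (hL : L.IsStrict)
    (hld : IsFibrewiseDense 𝒱.hom (Set.range (el ≫ L.mul).base))
    (hcover : Set.range i₁.left.base ∪ Set.range i₂.left.base = Set.univ)
    (hVfst : ∀ v : 𝒱.left, IsPreirreducible ((fst 𝒱 𝒱).left.base ⁻¹' {v}))
    (hWfst : ∀ w : 𝒲.left, IsPreirreducible ((fst 𝒲 𝒲).left.base ⁻¹' {w}))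
    (hWsnd : ∀ w : 𝒲.left, IsPreirreducible ((snd 𝒲 𝒲).left.base ⁻¹' {w}))
    (hWS : ∀ t : S, IsPreirreducible ((𝒲 ⊗ 𝒲).hom.base ⁻¹' {t})) :
    ∃ L'' : BirationalGroupLaw 𝒲, L''.IsStrict ∧
      ∃ φ : (L.dom : Scheme.{u}) ⟶ (L''.dom : Scheme.{u}),
        φ ≫ L''.dom.ι = L.dom.ι ≫ (i₁ ⊗ₘ i₁).left ∧ φ ≫ L''.mul = L.mul ≫ i₁.left := by
  haveI := hρo
  haveI := hlo
  haveI : IsOpenImmersion (i₁ ⊗ₘ i₁).left := isOpenImmersion_tensorHom_left i₁ i₁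
  haveI : IsOpenImmersion (i₁ ⊗ₘ i₂).left := isOpenImmersion_tensorHom_left i₁ i₂
  haveI : IsOpenImmersion (i₂ ⊗ₘ i₁).left := isOpenImmersion_tensorHom_left i₂ i₁
  haveI : IsOpenImmersion (i₂ ⊗ₘ i₂).left := isOpenImmersion_tensorHom_left i₂ i₂
  -- the law data and its shears (part III) and its densities (part IV)
  obtain ⟨D, m, hm, ψ₁₁, ψ₁₂, ψ₂₁, hψ₁₁, gψ₁₁, hψ₁₂, gψ₁₂, hψ₂₁, gψ₂₁, -, hΦo, hΨo⟩ :=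
    exists_gluedLawData L i₁ i₂ s σ hσ₁ hσ₂ A eρ heρ hρo hglue σ' hσ'₁ hσ'₂ A' el hel hlo πV πA θι θl hθι₁ hθι₂
      hθl₁ hθl₂ hP hPl hA hA'
  obtain ⟨hstrict, dS, dΦS, dΨS⟩ := isFibrewiseDense_gluedLawData L i₁ i₂ el πV θι θl hθι₁ hθl₁ hPl D m hm ψ₁₁ ψ₁₂
    ψ₂₁ hψ₁₁ gψ₁₁ hψ₁₂ gψ₁₂ hψ₂₁ hΦo hΨo hL hld hcover hVfst hWfst hWsnd hWS
  -- associativity: the sub-law on `D₀ = (i₁ ⊗ i₁)(dom)` is the transported law of `L`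
  haveI : Nonempty (L.dom : Scheme.{u}) := by
    obtain ⟨z, hz⟩ := L.dense_dom.dense.nonempty; exact ⟨⟨z, hz⟩⟩
  let χ₁₁ : (L.dom : Scheme.{u}) ⟶ (𝒲 ⊗ 𝒲).left := L.dom.ι ≫ (i₁ ⊗ₘ i₁).left
  have hle : χ₁₁.opensRange ≤ D := by
    rintro _ ⟨d, rfl⟩
    have : (ψ₁₁ ≫ D.ι).base d ∈ (D : Set ↑(𝒲 ⊗ 𝒲).left) := by
      rw [← Scheme.Opens.range_ι]; exact ⟨ψ₁₁.base d, rfl⟩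
    rwa [hψ₁₁] at this
  have hψ : χ₁₁.isoOpensRange.hom ≫ (𝒲 ⊗ 𝒲).left.homOfLE hle = ψ₁₁ := by
    rw [← cancel_mono D.ι, Category.assoc, Scheme.homOfLE_ι, Scheme.Hom.isoOpensRange_hom_ι, hψ₁₁]
  have hkey : (𝒲 ⊗ 𝒲).left.homOfLE hle ≫ m = χ₁₁.isoOpensRange.inv ≫ L.mul ≫ i₁.left := by
    rw [← cancel_epi χ₁₁.isoOpensRange.hom, reassoc_of% hψ, gψ₁₁, Iso.hom_inv_id_assoc]
  have hassoc₀ : ∀ {T : Scheme.{u}} {a b c ab bc abc abc' : T ⟶ 𝒲.left}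
      {q₁ q₂ q₃ q₄ : T ⟶ (χ₁₁.opensRange : Scheme.{u})},
      LawData.Computes 𝒲 χ₁₁.opensRange ((𝒲 ⊗ 𝒲).left.homOfLE hle ≫ m) q₁ a b ab →
      LawData.Computes 𝒲 χ₁₁.opensRange ((𝒲 ⊗ 𝒲).left.homOfLE hle ≫ m) q₂ b c bc →
      LawData.Computes 𝒲 χ₁₁.opensRange ((𝒲 ⊗ 𝒲).left.homOfLE hle ≫ m) q₃ ab c abc →
      LawData.Computes 𝒲 χ₁₁.opensRange ((𝒲 ⊗ 𝒲).left.homOfLE hle ≫ m) q₄ a bc abc' → abc = abc' := by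
    rw [hkey]
    intro T a b c ab bc abc abc' q₁ q₂ q₃ q₄ h₁ h₂ h₃ h₄
    exact L.assoc_chart i₁ h₁ h₂ h₃ h₄
  -- a non-empty configuration of witnesses `(x, b)`, `(b, s)`, `(x b, s)`, `(x, b s)` over `Ω ⊆ 𝒱 ×_S A`
  have hρS : (eρ ≫ L.mul) ≫ 𝒱.hom = A.ι ≫ 𝒱.hom := by
    rw [Category.assoc, L.mul_comp, ← Category.assoc, heρ, Category.assoc, ← Over.w (fst 𝒱 𝒱),
      ← Category.assoc σ, hσ₁, Category.id_comp]
  let AO : Over S := Over.mk (A.ι ≫ 𝒱.hom)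
  let ιO : AO ⟶ 𝒱 := Over.homMk A.ι rfl
  let ρO : AO ⟶ 𝒱 := Over.homMk (eρ ≫ L.mul) hρS
  haveI : IsOpenImmersion ιO.left := inferInstanceAs (IsOpenImmersion A.ι)
  haveI : IsOpenImmersion ρO.left := inferInstanceAs (IsOpenImmersion (eρ ≫ L.mul))
  haveI : IsOpenImmersion (𝟙 𝒱 : 𝒱 ⟶ 𝒱).left := by change IsOpenImmersion (𝟙 𝒱.left); infer_instance
  let Q : Scheme.{u} := (𝒱 ⊗ AO).left
  let qA : Q ⟶ (A : Scheme.{u}) := (snd 𝒱 AO).left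
  let θ' : Q ⟶ (𝒱 ⊗ 𝒱).left := (𝟙 𝒱 ⊗ₘ ιO).left
  let θ : Q ⟶ (𝒱 ⊗ 𝒱).left := (𝟙 𝒱 ⊗ₘ ρO).left
  haveI : IsOpenImmersion θ' := isOpenImmersion_tensorHom_left' (𝟙 𝒱) ιO
  haveI : IsOpenImmersion θ := isOpenImmersion_tensorHom_left' (𝟙 𝒱) ρO
  have hθ'1 : θ' ≫ (fst 𝒱 𝒱).left = (fst 𝒱 AO).left := by
    change (𝟙 𝒱 ⊗ₘ ιO).left ≫ (fst 𝒱 𝒱).left = _; rw [tensorHom_left_fst_left']; exact Category.comp_id _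
  have hθ'2 : θ' ≫ (snd 𝒱 𝒱).left = qA ≫ A.ι := tensorHom_left_snd_left' (𝟙 𝒱) ιO
  have hθ1 : θ ≫ (fst 𝒱 𝒱).left = (fst 𝒱 AO).left := by
    change (𝟙 𝒱 ⊗ₘ ρO).left ≫ (fst 𝒱 𝒱).left = _; rw [tensorHom_left_fst_left']; exact Category.comp_id _
  have hθ2 : θ ≫ (snd 𝒱 𝒱).left = qA ≫ eρ ≫ L.mul := tensorHom_left_snd_left' (𝟙 𝒱) ρO
  obtain ⟨a₀, ha₀⟩ := hA
  have ha₀' : a₀ ∈ Set.range A.ι.base := by rw [Scheme.Opens.range_ι]; exact ha₀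
  obtain ⟨a₁, ha₁⟩ := ha₀'
  haveI : Nonempty Q := by
    obtain ⟨z, -, -⟩ := Scheme.Pullback.exists_preimage_pullback (f := 𝒱.hom) (g := AO.hom) a₀ a₁
      (by change 𝒱.hom.base a₀ = (A.ι ≫ 𝒱.hom).base a₁; rw [Scheme.Hom.comp_base, TopCat.coe_comp,
        Function.comp_apply, ha₁])
    exact ⟨z⟩
  haveI : IrreducibleSpace Q := θ'.isOpenEmbedding.irreducibleSpace
  let U₂ : (𝒱 ⊗ 𝒱).left.Opens := L.dom.ι ''ᵁ (L.mul ⁻¹ᵁ A)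
  let Ω : Q.Opens := θ' ⁻¹ᵁ L.dom ⊓ θ ⁻¹ᵁ L.dom ⊓ θ' ⁻¹ᵁ U₂
  have hdomne : ((L.dom : Set ↑(𝒱 ⊗ 𝒱).left)).Nonempty := L.dense_dom.dense.nonempty
  have meet : ∀ (U V : (𝒱 ⊗ 𝒱).left.Opens), (U : Set ↑(𝒱 ⊗ 𝒱).left).Nonempty →
      (V : Set ↑(𝒱 ⊗ 𝒱).left).Nonempty → ((U : Set ↑(𝒱 ⊗ 𝒱).left) ∩ V).Nonempty := fun U V hU hV =>
    nonempty_preirreducible_inter U.2 V.2 hU hV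
  have hN : ∀ (g : Q ⟶ (𝒱 ⊗ 𝒱).left) [IsOpenImmersion g] (V : (𝒱 ⊗ 𝒱).left.Opens),
      (V : Set ↑(𝒱 ⊗ 𝒱).left).Nonempty → ((g ⁻¹ᵁ V : Q.Opens) : Set Q).Nonempty := by
    intro g _ V hV
    obtain ⟨_, ⟨p, rfl⟩, hp⟩ := meet g.opensRange V ⟨_, Classical.arbitrary Q, rfl⟩ hV
    exact ⟨p, hp⟩
  haveI hΨ'o := L.isOpenImmersion_shearRight
  have hU₂ : (U₂ : Set ↑(𝒱 ⊗ 𝒱).left).Nonempty := by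
    obtain ⟨w₀, hw₀, -⟩ := Scheme.Pullback.exists_preimage_pullback (f := 𝒱.hom) (g := 𝒱.hom) a₀ a₀ rfl
    obtain ⟨d₀, hd₀⟩ := hdomne
    obtain ⟨_, ⟨z, rfl⟩, hz⟩ := meet L.shearRight.left.opensRange ((fst 𝒱 𝒱).left ⁻¹ᵁ A)
      ⟨_, ⟨d₀, hd₀⟩, rfl⟩ ⟨w₀, show (pullback.fst 𝒱.hom 𝒱.hom).base w₀ ∈ A by rw [hw₀]; exact ha₀⟩
    have hz' : L.mul.base z ∈ A := by
      have : (fst 𝒱 𝒱).left.base (L.shearRight.left.base z) ∈ A := hz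
      rwa [L.fst_shearRight_base] at this
    exact ⟨L.dom.ι.base z, z, hz', rfl⟩
  have hΩ : (Ω : Set Q).Nonempty :=
    nonempty_preirreducible_inter (θ' ⁻¹ᵁ L.dom ⊓ θ ⁻¹ᵁ L.dom).2 (θ' ⁻¹ᵁ U₂).2
      (nonempty_preirreducible_inter (θ' ⁻¹ᵁ L.dom).2 (θ ⁻¹ᵁ L.dom).2 (hN θ' L.dom hdomne) (hN θ L.dom hdomne))
      (hN θ' U₂ hU₂)
  haveI : Nonempty (Ω : Scheme.{u}) := by obtain ⟨p, hp⟩ := hΩ; exact ⟨⟨p, hp⟩⟩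
  have memΩ : ∀ q : (Ω : Scheme.{u}), θ'.base (Ω.ι.base q) ∈ L.dom ∧ θ.base (Ω.ι.base q) ∈ L.dom ∧
      θ'.base (Ω.ι.base q) ∈ U₂ := fun q => by
    have : Ω.ι.base q ∈ Ω := by rw [← SetLike.mem_coe, ← Scheme.Opens.range_ι]; exact ⟨q, rfl⟩
    exact ⟨this.1.1, this.1.2, this.2⟩
  have r₁ : Set.range (Ω.ι ≫ θ').base ⊆ Set.range L.dom.ι.base := by
    rintro _ ⟨q, rfl⟩; rw [Scheme.Opens.range_ι]; exact (memΩ q).1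
  obtain ⟨p₁, hp₁⟩ : ∃ p₁ : (Ω : Scheme.{u}) ⟶ (L.dom : Scheme.{u}), p₁ ≫ L.dom.ι = Ω.ι ≫ θ' :=
    ⟨IsOpenImmersion.lift L.dom.ι (Ω.ι ≫ θ') r₁, IsOpenImmersion.lift_fac _ _ _⟩
  have r₃ : Set.range (p₁ ≫ L.mul).base ⊆ Set.range A.ι.base := by
    rintro _ ⟨q, rfl⟩
    rw [Scheme.Opens.range_ι]
    obtain ⟨z, hz, hz'⟩ := (memΩ q).2.2
    have e : L.dom.ι.base (p₁.base q) = L.dom.ι.base z := by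
      change (p₁ ≫ L.dom.ι).base q = _; rw [hp₁]; exact hz'.symm
    have : p₁.base q = z := L.dom.ι.isOpenEmbedding.injective e
    change L.mul.base (p₁.base q) ∈ A
    rw [this]; exact hz
  obtain ⟨a₃, ha₃⟩ : ∃ a₃ : (Ω : Scheme.{u}) ⟶ (A : Scheme.{u}), a₃ ≫ A.ι = p₁ ≫ L.mul :=
    ⟨IsOpenImmersion.lift A.ι (p₁ ≫ L.mul) r₃, IsOpenImmersion.lift_fac _ _ _⟩
  have r₄ : Set.range (Ω.ι ≫ θ).base ⊆ Set.range L.dom.ι.base := by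
    rintro _ ⟨q, rfl⟩; rw [Scheme.Opens.range_ι]; exact (memΩ q).2.1
  obtain ⟨p₄, hp₄⟩ : ∃ p₄ : (Ω : Scheme.{u}) ⟶ (L.dom : Scheme.{u}), p₄ ≫ L.dom.ι = Ω.ι ≫ θ :=
    ⟨IsOpenImmersion.lift L.dom.ι (Ω.ι ≫ θ) r₄, IsOpenImmersion.lift_fac _ _ _⟩
  have eρ_fst : eρ ≫ L.dom.ι ≫ (fst 𝒱 𝒱).left = A.ι := by
    rw [← Category.assoc, heρ, Category.assoc, hσ₁, Category.comp_id]
  have eρ_snd : eρ ≫ L.dom.ι ≫ (snd 𝒱 𝒱).left = A.ι ≫ 𝒱.hom ≫ s := by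
    rw [← Category.assoc, heρ, Category.assoc, hσ₂]
  have mul_hom : L.mul ≫ 𝒱.hom = L.dom.ι ≫ (snd 𝒱 𝒱).left ≫ 𝒱.hom := by rw [L.mul_comp, Over.w (snd 𝒱 𝒱)]
  have p₁_fst : p₁ ≫ L.dom.ι ≫ (fst 𝒱 𝒱).left = Ω.ι ≫ (fst 𝒱 AO).left := by
    rw [← Category.assoc, hp₁, Category.assoc, hθ'1]
  have p₁_snd : p₁ ≫ L.dom.ι ≫ (snd 𝒱 𝒱).left = Ω.ι ≫ qA ≫ A.ι := by
    rw [← Category.assoc, hp₁, Category.assoc, hθ'2]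
  have p₄_fst : p₄ ≫ L.dom.ι ≫ (fst 𝒱 𝒱).left = Ω.ι ≫ (fst 𝒱 AO).left := by
    rw [← Category.assoc, hp₄, Category.assoc, hθ1]
  have p₄_snd : p₄ ≫ L.dom.ι ≫ (snd 𝒱 𝒱).left = Ω.ι ≫ qA ≫ eρ ≫ L.mul := by
    rw [← Category.assoc, hp₄, Category.assoc, hθ2]
  have c₁ : LawData.Computes 𝒱 L.dom L.mul p₁ (Ω.ι ≫ (fst 𝒱 AO).left) (Ω.ι ≫ qA ≫ A.ι) (p₁ ≫ L.mul) :=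
    ⟨p₁_fst, p₁_snd, rfl⟩
  have c₂ : LawData.Computes 𝒱 L.dom L.mul (Ω.ι ≫ qA ≫ eρ) (Ω.ι ≫ qA ≫ A.ι) ((Ω.ι ≫ qA ≫ A.ι) ≫ 𝒱.hom ≫ s)
      ((Ω.ι ≫ qA ≫ eρ) ≫ L.mul) :=
    ⟨by simp only [Category.assoc, eρ_fst], by simp only [Category.assoc, eρ_snd], rfl⟩
  have c₃ : LawData.Computes 𝒱 L.dom L.mul (a₃ ≫ eρ) (p₁ ≫ L.mul) ((Ω.ι ≫ qA ≫ A.ι) ≫ 𝒱.hom ≫ s)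
      ((a₃ ≫ eρ) ≫ L.mul) := by
    refine ⟨by rw [Category.assoc, eρ_fst, ha₃], ?_, rfl⟩
    rw [Category.assoc, eρ_snd, reassoc_of% ha₃, reassoc_of% mul_hom, reassoc_of% p₁_snd]
    simp only [Category.assoc]
  have c₄ : LawData.Computes 𝒱 L.dom L.mul p₄ (Ω.ι ≫ (fst 𝒱 AO).left) ((Ω.ι ≫ qA ≫ eρ) ≫ L.mul) (p₄ ≫ L.mul) :=
    ⟨p₄_fst, by rw [p₄_snd]; simp only [Category.assoc], rfl⟩
  -- the configuration, transported to the sub-law `(D₀, m|D₀)`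
  have hne : ∃ (T : Scheme.{u}) (_ : Nonempty T) (a b c ab bc abc abc' : T ⟶ 𝒲.left)
      (q₁ q₂ q₃ q₄ : T ⟶ (χ₁₁.opensRange : Scheme.{u})),
      LawData.Computes 𝒲 χ₁₁.opensRange ((𝒲 ⊗ 𝒲).left.homOfLE hle ≫ m) q₁ a b ab ∧
      LawData.Computes 𝒲 χ₁₁.opensRange ((𝒲 ⊗ 𝒲).left.homOfLE hle ≫ m) q₂ b c bc ∧
      LawData.Computes 𝒲 χ₁₁.opensRange ((𝒲 ⊗ 𝒲).left.homOfLE hle ≫ m) q₃ ab c abc ∧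
      LawData.Computes 𝒲 χ₁₁.opensRange ((𝒲 ⊗ 𝒲).left.homOfLE hle ≫ m) q₄ a bc abc' := by
    rw [hkey]
    exact ⟨Ω, inferInstance, _, _, _, _, _, _, _, _, _, _, _, L.computes_chart i₁ i₁ i₁ c₁, L.computes_chart i₁ i₁ i₁ c₂,
      L.computes_chart i₁ i₁ i₁ c₃, L.computes_chart i₁ i₁ i₁ c₄⟩
  -- the birational group law on `𝒲`
  refine ⟨⟨D, m, hm, dS, hΦo, dΦS, hΨo, dΨS, fun h₁ h₂ h₃ h₄ =>
    LawData.assoc_of_le χ₁₁.opensRange D hle m hm hassoc₀ hne h₁ h₂ h₃ h₄⟩, hstrict, ψ₁₁, hψ₁₁, gψ₁₁⟩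

end Head

end Literature.AlgebraicGeometry.GroupSchemes

end
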